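import Mathlib
import Summits.CriticalPhenomena.CardyFormulaZ2.Theorems.CardyMagicRigidityNestingRigidityLatticeRegularityZ2
import Summits.CriticalPhenomena.CardyFormulaZ2.Theorems.CardyMagicRigidityNestingRigidityLatticeRegularityT
import Literature.Probability.Percolation.OrbitLoopWinding
import HarnessLib

/-!
# Lattice regularity of the bond-`ℤ²` loop ensemble: trace = frontier of the interior; separation

Crux `Summit.CriticalPhenomena.CardyFormulaZ2.Theses.CardyMagicRigidity.NestingRigidity`
(stmt-CriticalPhenomena-4835), line `positive-cone-weight-doubling`, helper toward the registered stub
`stub_precompactness : PrecompactRegular zEns ∧ PrecompactRegular tEns` (and `stub_treeRigidity`),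
completing `…LatticeRegularityZ2` (fields `degreeOne`, `laminar`, `locallyFinite`) with the two
remaining fields of `Regular` for the typed loop representation `zEns.X δ ω = bondLoopConfig δ 0 ω`
of a bond configuration of `ℤ²` at mesh `δ > 0`:

* `boundary_zEns` — **the trace of every loop is the frontier of its winding interior**.  `⊇` holds
  for every loop (the winding number is locally constant off the trace,
  `frontier_setOf_wind_ne_zero_subset_range`); `⊆`: a trace point lies on the corner cut of a dart
  of the loop (`exists_cornerCut_of_mem_range_loopCurve`), across which the winding number jumps by
  one (`IsInterfaceLoop.wind_meshPoint_eq_wind_faceCenter_add_one`), so one of the two adjacent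
  cells has non-zero winding number, and the open segment from its centre to the point misses the
  trace (`IsInterfaceLoop.wind_eq_wind_of_l1DistC_le`): the point is a limit of interior points;
* `separating_zEns` — **two loops with the same winding interior coincide**: their traces coincide
  (frontiers), the midpoint of the first dart segment of one lies on a dart segment of the other,
  distinct medial darts meet only at medial points (`IsMedialDart.segment_inter_segment_subset`), so
  the two dart lists share a dart and are rotations of each other (`IsInterfaceLoop.rotate_eq_of_corner`),
  drawing the same unbased loop (`unbasedLoop_loopCurve_rotate`);
* `regular_zEns` — hence `zEns.X δ ω` is `Regular` for every `δ > 0` and every `ω`; with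
  `regular_tEns` (`…LatticeRegularityT`), `regular_latticeEnsembles`: BOTH lattice ensembles of the
  crux have regular configurations at every positive mesh, surely (not just almost surely).
-/

noncomputable section

open MeasureTheory Set Filter Metric
open scoped Real Topology BigOperators

namespace Summit.CriticalPhenomena.CardyFormulaZ2.Cruxes.NestingRigidity.PositiveConeWeightDoubling

open Literature.Probability.RandomPlanarGeometry Literature.Probability.Percolation
  Literature.Probability.LatticeModels
open Summit.CriticalPhenomena.CardyFormulaZ2.Cruxes.NestingRigidity.RingCloudTomography
open Summit.CriticalPhenomena.CardyFormulaZ2.Cruxes.NestingRigidity.MarkovCascadeOneGeneration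

/-! ## §1 The frontier of the winding interior lies on the trace (any loop) -/

/-- **The frontier of the winding interior of a loop lies on its trace**: off the trace the winding
number is locally constant (`UnbasedLoop.wind_eq_wind_of_dist_lt`), so a point off the trace is
interior to `{W ≠ 0}` or to `{W = 0}`. -/
theorem frontier_setOf_wind_ne_zero_subset_range (u : UnbasedLoop ℂ) :
    frontier {z | u.wind z ≠ 0} ⊆ u.range := by
  intro z hz
  by_contra hzr
  have hpos : 0 < infDist z u.range :=
    (u.isCompact_range.isClosed.notMem_iff_infDist_pos u.range_nonempty).1 hzr
  have hball : ∀ w ∈ ball z (infDist z u.range), u.wind w = u.wind z := fun w hw ↦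
    u.wind_eq_wind_of_dist_lt (mem_ball.1 hw)
  rw [frontier_eq_closure_inter_closure] at hz
  by_cases h0 : u.wind z = 0
  · obtain ⟨w, hw, hws⟩ := mem_closure_iff_nhds.1 hz.1 _ (ball_mem_nhds z hpos)
    exact hws (by rw [hball w hw]; exact h0)
  · obtain ⟨w, hw, hws⟩ := mem_closure_iff_nhds.1 hz.2 _ (ball_mem_nhds z hpos)
    exact hws (by rw [mem_setOf_eq, hball w hw]; exact h0)

/-! ## §2 One medial interface loop at mesh `1` -/

section MeshOne

variable {ω : BondConfig (Site 2)} {γ γ' : List MedialVertex}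

/-- **Every trace point of an interface loop is a limit of interior points** (mesh `1`): it lies on
the corner cut of a dart, one of whose two cells has non-zero winding number (jump relation), and
the open segment from that cell's centre to the point is off the trace and carries that winding
number. -/
theorem range_loopCurve_subset_closure (h : IsInterfaceLoop ω γ) :
    (loopCurve 1 0 γ).range ⊆ closure {z | (loopCurve 1 0 γ).wind z ≠ 0} := by
  intro x hx
  obtain ⟨q, hq, v, f, hv, hs, ht, hxc⟩ := exists_cornerCut_of_mem_range_loopCurve h hx
  have hd : (cornerSource v f, cornerTarget v f) ∈ γ.zip (γ.rotate 1) := by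
    rw [hs, ht]; exact hq
  have hj := h.wind_meshPoint_eq_wind_faceCenter_add_one hv hd
  -- a cell centre `c` with `W c ≠ 0`, `x` in its closed cell, the trace `ℓ¹`-far from `c`
  obtain ⟨c, hc0, hxc', hfar⟩ : ∃ c : ℂ, (loopCurve 1 0 γ).wind c ≠ 0 ∧ l1DistC x c ≤ 1 / 2 ∧
      ∀ y ∈ (loopCurve 1 0 γ).range, 1 / 2 ≤ l1DistC y c := by
    by_cases h0 : (loopCurve 1 0 γ).wind (faceCenter f) = 0
    · refine ⟨meshPoint 1 v, by rw [hj, h0]; norm_num, ?_, fun y hy ↦ h.half_le_l1DistC_meshPoint hy v⟩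
      exact (l1DistC_meshPoint_eq_of_mem_cornerCut hv hxc).le
    · exact ⟨faceCenter f, h0, (l1DistC_eq_of_mem_cornerCut hv hxc).le,
        fun y hy ↦ h.half_le_l1DistC_faceCenter hy f⟩
  have hdx : 0 ≤ l1DistC x c := by unfold l1DistC; positivity
  -- the open segment from `c` to `x` lies in `{W ≠ 0}`
  have hseg : openSegment ℝ c x ⊆ {z | (loopCurve 1 0 γ).wind z ≠ 0} := by
    intro y hy
    rw [openSegment_eq_image'] at hy
    obtain ⟨t, ⟨ht0, ht1⟩, rfl⟩ := hy
    have hyc : l1DistC (c + t • (x - c)) c ≤ 1 / 2 := by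
      rw [l1DistC_add_smul c x t ht0.le]; nlinarith
    have hyr : c + t • (x - c) ∉ (loopCurve 1 0 γ).range := by
      intro hmem
      have h1 := hfar _ hmem
      rw [l1DistC_add_smul c x t ht0.le] at h1
      nlinarith
    show (loopCurve 1 0 γ).wind (c + t • (x - c)) ≠ 0
    rw [h.wind_eq_wind_of_l1DistC_le hyr hyc hfar]
    exact hc0
  exact closure_mono hseg (segment_subset_closure_openSegment (right_mem_segment ℝ c x))

/-- **Trace = frontier of the winding interior** for a medial interface loop at mesh `1`. -/
theorem range_loopCurve_eq_frontier (h : IsInterfaceLoop ω γ) :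
    (loopCurve 1 0 γ).range = frontier {z | (loopCurve 1 0 γ).wind z ≠ 0} := by
  refine Subset.antisymm (fun x hx ↦ ?_) (frontier_setOf_wind_ne_zero_subset_range
    (UnbasedLoop.mk (BasedLoop.mk (loopCurve 1 0 γ) (isLoop_loopCurve 1 0 h.ne_nil))))
  rw [frontier_eq_closure_inter_closure]
  refine ⟨range_loopCurve_subset_closure h hx, subset_closure ?_⟩
  show ¬ ((loopCurve 1 0 γ).wind x ≠ 0)
  rw [not_not]
  exact CurveClass.wind_of_mem_range _ hx

/-- The two medial points of a medial dart are distinct (the dart has length `√2/2`). -/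
theorem medialPoint_ne_of_isMedialDart {e e' : MedialVertex} (hd : IsMedialDart e e') :
    medialPoint 1 e ≠ medialPoint 1 e' := by
  obtain ⟨v, f, hv, rfl, rfl⟩ := hd
  intro heq
  have h := norm_medialPoint_cornerTarget_sub_cornerSource hv
  rw [heq, sub_self, norm_zero] at h
  have : (0 : ℝ) < Real.sqrt 2 / 2 := by positivity
  linarith

/-- **Two interface loops of one configuration, the trace of the first contained in that of the
second, are rotations of each other**: the midpoint of the first dart segment of `γ` lies on a dart
segment of `γ'`, which must be the same dart (distinct medial darts meet only at medial points), and
interface loops of `ω` sharing a dart are rotations of one another (`rotate_eq_of_corner`). -/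
theorem exists_rotate_eq_of_range_subset (h : IsInterfaceLoop ω γ) (h' : IsInterfaceLoop ω γ')
    (hr : (loopCurve 1 0 γ).range ⊆ (loopCurve 1 0 γ').range) : ∃ k : ℕ, γ.rotate k = γ' := by
  have hn : 0 < γ.length := h.length_pos
  -- the first dart of `γ` and the midpoint of its segment
  have hd : (γ[0], γ[(0 + 1) % γ.length]'(Nat.mod_lt _ hn)) ∈ γ.zip (γ.rotate 1) :=
    getElem_mem_zip_rotate hn
  set e : MedialVertex := γ[0] with he
  set e' : MedialVertex := γ[(0 + 1) % γ.length]'(Nat.mod_lt _ hn) with he'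
  have hmd : IsMedialDart e e' := h.isMedialDart_of_mem_zip hd
  set x : ℂ := midpoint ℝ (medialPoint 1 e) (medialPoint 1 e') with hxdef
  have hxseg : x ∈ segment ℝ (medialPoint 1 e) (medialPoint 1 e') := midpoint_mem_segment _ _
  have hx : x ∈ (loopCurve 1 0 γ).range := by
    rw [range_loopCurve_one_zero h.ne_nil]
    exact mem_iUnion₂.2 ⟨(e, e'), hd, hxseg⟩
  -- `x` lies on a dart segment of `γ'`, which is the segment of `(e, e')`
  have hx' := hr hx
  rw [range_loopCurve_one_zero h'.ne_nil] at hx'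
  obtain ⟨⟨f₁, f₂⟩, hq, hxq⟩ := mem_iUnion₂.1 hx'
  have hqe : (e, e') = (f₁, f₂) := by
    by_contra hne
    have key := hmd.segment_inter_segment_subset (h'.isMedialDart_of_mem_zip hq) hne ⟨hxseg, hxq⟩
    have hne_pts := medialPoint_ne_of_isMedialDart hmd
    rcases key.1 with hx0 | hx0
    · exact hne_pts ((midpoint_eq_left_iff ℝ).1 hx0)
    · exact hne_pts ((midpoint_eq_right_iff ℝ).1 hx0)
  obtain ⟨h₁, h₂⟩ := Prod.mk.inj hqe
  subst h₁ h₂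
  -- positions of the common dart
  obtain ⟨j, hj, hje, hje'⟩ := exists_getElem_of_mem_zip_rotate hq
  obtain ⟨p, hps, hpt⟩ := h.exists_corner 0
  refine ⟨0 + γ.length - j, h.rotate_eq_of_corner h' hn hj hps hpt ?_ ?_⟩
  · calc cSrc p = γ[0 % γ.length]'(Nat.mod_lt _ hn) := hps
      _ = γ[0] := IsInterfaceLoop.getElem_idx_congr (Nat.zero_mod _) _
      _ = e := he.symm
      _ = γ'[j] := hje.symm
      _ = γ'[j % γ'.length]'(Nat.mod_lt _ h'.length_pos) :=
        IsInterfaceLoop.getElem_idx_congr (Nat.mod_eq_of_lt hj).symm _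
  · calc cTgt p = γ[(0 + 1) % γ.length]'(Nat.mod_lt _ hn) := hpt
      _ = e' := he'.symm
      _ = γ'[(j + 1) % γ'.length]'(Nat.mod_lt _ h'.length_pos) := hje'.symm

/-- **Two interface loops of one configuration with the same winding interior draw the same unbased
loop** (mesh `1`): equal interiors have equal frontiers, i.e. equal traces, so the lists are
rotations of each other. -/
theorem unbasedLoop_eq_of_interior_eq_one (h : IsInterfaceLoop ω γ) (h' : IsInterfaceLoop ω γ')
    (hint : {z | (loopCurve 1 0 γ).wind z ≠ 0} = {z | (loopCurve 1 0 γ').wind z ≠ 0}) :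
    UnbasedLoop.mk (BasedLoop.mk (loopCurve 1 0 γ) (isLoop_loopCurve 1 0 h.ne_nil)) =
      UnbasedLoop.mk (BasedLoop.mk (loopCurve 1 0 γ') (isLoop_loopCurve 1 0 h'.ne_nil)) := by
  have hr : (loopCurve 1 0 γ).range = (loopCurve 1 0 γ').range := by
    rw [range_loopCurve_eq_frontier h, range_loopCurve_eq_frontier h', hint]
  obtain ⟨k, rfl⟩ := exists_rotate_eq_of_range_subset h h' hr.subset
  exact (unbasedLoop_loopCurve_rotate 1 0 h.ne_nil k).symm

end MeshOne

/-! ## §3 The loops of `zEns.X δ ω` -/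

/-- **Trace = frontier of the winding interior on bond-`ℤ²`** (field `Regular.boundary` at the
lattice level): at mesh `δ > 0`, the trace of every loop of `zEns.X δ ω` is the frontier of
`{z | W ≠ 0}`. -/
theorem boundary_zEns : ∀ {δ : ℝ}, 0 < δ → ∀ (ω : BondConfig (Site 2)), ∀ u ∈ (zEns.X δ ω).loops, u.range = frontier {z | u.wind z ≠ 0} := by
  intro δ hδ ω u hu
  refine Subset.antisymm (fun x hx ↦ ?_) (frontier_setOf_wind_ne_zero_subset_range u)
  obtain ⟨γ, hγ, rfl⟩ := mem_loops_zEns_iff.1 hu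
  have hδ' : (δ : ℂ) ≠ 0 := Complex.ofReal_ne_zero.2 hδ.ne'
  have hx0 : (loopCurve δ 0 γ).wind x = 0 := CurveClass.wind_of_mem_range _ hx
  have hx' : x ∈ (loopCurve δ 0 γ).range := hx
  rw [loopCurve_eq_map_mul, CurveClass.range_map] at hx'
  obtain ⟨w, hw, rfl⟩ := hx'
  rw [frontier_eq_closure_inter_closure]
  refine ⟨?_, subset_closure (by rw [mem_compl_iff, mem_setOf_eq, not_not]; exact hx0)⟩
  have hcont : Continuous fun z : ℂ ↦ (δ : ℂ) * z := by fun_prop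
  refine closure_mono ?_ (image_closure_subset_closure_image hcont
    ⟨w, range_loopCurve_subset_closure hγ hw, rfl⟩)
  rintro _ ⟨z, hz, rfl⟩
  show (loopCurve δ 0 γ).wind ((δ : ℂ) * z) ≠ 0
  rw [wind_loopCurve_mesh hδ.ne', mul_div_cancel_left₀ _ hδ']
  exact hz

/-- **Loops of `zEns.X δ ω` with equal winding interiors are equal** (`δ > 0`; the strong form of
`Regular.separating` on the lattice). -/
theorem eq_of_interior_eq_zEns {δ : ℝ} (hδ : 0 < δ) {ω : BondConfig (Site 2)} {u v : UnbasedLoop ℂ}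
    (hu : u ∈ (zEns.X δ ω).loops) (hv : v ∈ (zEns.X δ ω).loops)
    (h : {z | u.wind z ≠ 0} = {z | v.wind z ≠ 0}) : u = v := by
  obtain ⟨γ, hγ, rfl⟩ := mem_loops_zEns_iff.1 hu
  obtain ⟨γ', hγ', rfl⟩ := mem_loops_zEns_iff.1 hv
  have hδ' : (δ : ℂ) ≠ 0 := Complex.ofReal_ne_zero.2 hδ.ne'
  -- interiors at mesh `1` coincide
  have h1 : {z | (loopCurve 1 0 γ).wind z ≠ 0} = {z | (loopCurve 1 0 γ').wind z ≠ 0} := by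
    have hs : Function.Surjective fun z : ℂ ↦ z / δ := fun w ↦ ⟨δ * w, mul_div_cancel_left₀ w hδ'⟩
    apply hs.preimage_injective
    rw [← setOf_wind_loopCurve_mesh hδ.ne' γ, ← setOf_wind_loopCurve_mesh hδ.ne' γ']
    exact h
  -- hence the lists are rotations of each other
  have hr : (loopCurve 1 0 γ).range = (loopCurve 1 0 γ').range := by
    rw [range_loopCurve_eq_frontier hγ, range_loopCurve_eq_frontier hγ', h1]
  obtain ⟨k, rfl⟩ := exists_rotate_eq_of_range_subset hγ hγ' hr.subset
  exact (unbasedLoop_loopCurve_rotate δ 0 hγ.ne_nil k).symm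

/-- **Separation on bond-`ℤ²`** (field `Regular.separating` at the lattice level): at mesh `δ > 0`,
two loops of `zEns.X δ ω` with the same winding interior are equal (or reverse to each other — the
first alternative always holds on the lattice). -/
theorem separating_zEns : ∀ {δ : ℝ}, 0 < δ → ∀ (ω : BondConfig (Site 2)), ∀ u ∈ (zEns.X δ ω).loops, ∀ v ∈ (zEns.X δ ω).loops, {z | u.wind z ≠ 0} = {z | v.wind z ≠ 0} → u = v ∨ u = v.reverse :=
  fun hδ _ _ hu _ hv h ↦ Or.inl (eq_of_interior_eq_zEns hδ hu hv h)

/-- **Lattice configurations of bond-`ℤ²` are regular**: at every mesh `δ > 0` and for every bond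
configuration `ω`, `zEns.X δ ω = bondLoopConfig δ 0 ω` satisfies all five fields of `Regular` — the
`δ > 0` input of "regularity passes to `d_CN`-limits" in `stub_precompactness`. -/
theorem regular_zEns : ∀ {δ : ℝ}, 0 < δ → ∀ (ω : BondConfig (Site 2)), Regular (zEns.X δ ω) :=
  fun hδ ω ↦
    { locallyFinite := locallyFinite_zEns hδ ω
      degreeOne := degreeOne_zEns hδ ω
      boundary := boundary_zEns hδ ω
      laminar := laminar_zEns hδ ω
      separating := separating_zEns hδ ω }

/-- **Both lattice ensembles of the crux have regular configurations at every positive mesh**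
(surely, for every sample): the `δ > 0` half of "regularity passes to `d_CN`-limits" for
`stub_precompactness`, uniformly over `latticeEnsembles = {zEns, tEns}`. -/
theorem regular_latticeEnsembles : ∀ E ∈ latticeEnsembles, ∀ {δ : ℝ}, 0 < δ → ∀ (ω : E.Ω), Regular (E.X δ ω) := by
  intro E hE δ hδ ω
  simp only [latticeEnsembles, Set.mem_insert_iff, Set.mem_singleton_iff] at hE
  rcases hE with rfl | rfl
  · exact regular_zEns hδ ω
  · exact regular_tEns hδ ω

end Summit.CriticalPhenomena.CardyFormulaZ2.Cruxes.NestingRigidity.PositiveConeWeightDoubling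

end
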